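import Summits.BirchSwinnertonDyer.BirchSwinnertonDyer.Theorems.PrintX10bMuPartOfPrintKSAnyClassNumber
import Summits.BirchSwinnertonDyer.BirchSwinnertonDyer.Theorems.PrintX10bControlGlueKSAnyClassNumber
import HarnessLib

/-!
# The KS μ-chain is CLASS-NUMBER-FREE, III (closed): the cyclic port and the coherent-pair μ-letter with torsion from Howard
# Thm. 1.6.1 + CGLS Thm. 4.1.1 ONLY, on every frame — ANY CLASS NUMBER (route-free)

Cell `run/shared/lean/pub/bsd-print-x9/`, seat bsd-line-x10b-p1 LEAD g11; `--supports stmt-BirchSwinnertonDyer-23055` (helper; consumers: this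
seat's ten-leaf census of crux 23055, x9-p1 LEAD g7's six-leaf display of row 9, x10b-p2's pinned light-frame twin). THEOREMS ONLY (no
definition, no `abbrev`, no named fact, no instance, no `sorry`); no `Theses` import.

The `_of_controlGlue` forms of `PrintX10bMuPartOfPrintKSAnyClassNumber` (part III) specialised at the kernel theorem
`HeegnerMuPartControlGlue.controlGlueKS_anyClassNumber` (part II, x10b-p1-w8 g9's `PrintX10bControlGlueKSAnyClassNumber`: the control-glue
letter without its three idle binders, from the landed (B4)/(B5) readout stubs):
* `portCyclic_anyClassNumber (h161 h411 hKS)`;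
* **`exists_coherentPair_isTorsion_muIneq_of_howard_kolyvaginSystem_anyClassNumber (h161 h411)`** — x9-p1 LEAD g7's p689159 §2 with
  EXACTLY the three hypotheses `¬ W.HasCM`, `MastellaZerman2026.HasPadicScalarImage W p`, `p ∣ NumberField.classNumber K` removed and
  nothing added: GIVEN Howard 2004 Thm. 1.6.1 (F-161) and CGLS 2022 Thm. 4.1.1 (F-411) BY NAME, on every `Thm413Hypotheses` frame with
  (irr_ℚ), (irr_K), (Heeg_p), `p ∤ N`, the sharp tower and `[K[p] : K[1]] = p − 1` — WHATEVER the class number of `K` — there are the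
  engine's `C`, `F` on `(Dt, β)` with both envelopes, the torsion clause and the μ-inequality clause.
So Mastella–Zerman 2026 Cor. 4.6 (the `p ∤ h_K` road of rows 9/10) is no longer needed wherever this letter is the input.
HONEST FRAMING: conditional on F-161 / F-411 (statement-only Literature facts); «beyond-print theorem»: no; no summit statement is proved;
BSD is NOT proved by any of this.

References: [Howard2004HeegnerKolyvagin] Thm. 1.6.1, proof of Thm. 2.2.10; [CastellaGrossiLeeSkinner2022] Thm. 4.1.1, Rem. 4.1.4, §3.2/§4.1;
[PerrinRiou1987BSMF] §3.4 Prop. 10.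
-/

set_option linter.dupNamespace false
set_option autoImplicit false

noncomputable section

open scoped Classical Pointwise ContRepresentation TensorProduct NumberField

open Function NumberField IsDedekindDomain Field
open Literature Literature.NumberTheory.EllipticCurves WeierstrassCurve
open Literature.NumberTheory.EllipticCurves.ModularForms
open Literature.NumberTheory.EllipticCurves.CastellaGrossiLeeSkinner2022
open Literature.NumberTheory.GaloisCohomology Literature.NumberTheory.GaloisCohomology.Howard2004
open Literature.NumberTheory.Automorphic
open Literature.NumberTheory.GaloisRepresentations Literature.NumberTheory.GaloisRepresentations.DiscreteGaloisModule
open Summit.BirchSwinnertonDyer.BirchSwinnertonDyer.Theorems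
open Summit.BirchSwinnertonDyer.BirchSwinnertonDyer.Theorems.HeegnerMuPartControlGlue (Stmt.kummerStrictOnFrames)

namespace Summit.BirchSwinnertonDyer.BirchSwinnertonDyer.Theorems.HeegnerMuPartKSAnyClassNumber

/-- **The cyclic port for ANY class number** (Howard Thm. 1.6.1 `h161`, CGLS Thm. 4.1.1 `h411`, the frame-restricted Kummer = strict letter
`hKS`): part III's `portCyclic_anyClassNumber_of_controlGlue` at the kernel theorem `HeegnerMuPartControlGlue.controlGlueKS_anyClassNumber`.
[cite: Howard2004HeegnerKolyvagin, Thm. 1.6.1 and Thm. 2.2.10 (proof)] [cite: CastellaGrossiLeeSkinner2022, Thm. 4.1.1 and Rem. 4.1.4] -/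
theorem portCyclic_anyClassNumber
    (h161 : Literature.NumberTheory.GaloisCohomology.Howard2004.thm161_dvrKolyvaginBound)
    (h411 : Literature.NumberTheory.EllipticCurves.CastellaGrossiLeeSkinner2022.thm411_exists_kolyvaginSystem_one_ne_zero)
    (hKS : Stmt.kummerStrictOnFrames) :
    ∀ (N : ℕ) [NeZero N] (W : WeierstrassCurve ℚ) [W.IsGloballyMinimal] (K : Type) [Field K] [NumberField K]
      (p : ℕ) [Fact p.Prime] (κ : ZpExtension K p) (γ : Field.absoluteGaloisGroup K)
      (jbar : AlgebraicClosure K →+* ℂ),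
      CastellaGrossiLeeSkinner2022.Thm413Hypotheses N W K p κ γ →
      W.HasIrreducibleModPGaloisRep p → (W.baseChange K).HasIrreducibleModPGaloisRep p →
      SatisfiesHeegnerHypothesis p K →
      ∀ (D : (W.baseChange K).LambdaAdicSelmerData κ γ)
        (C : CastellaGrossiLeeSkinner2022.StabilizedHeegnerData N W K κ jbar)
        (X : (W.baseChange K).SelmerDualData κ γ) (z : D.S),
      (∀ (k : ℕ) (hk : C.depth < k), D.proj k z ∈ CastellaGrossiLeeSkinner2022.stabilizedClassLayer C k hk) →
      CastellaGrossiLeeSkinner2022.stabilizedHeegnerModule D C = Submodule.span (IwasawaAlgebra p) {z} →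
      Module.Finite (IwasawaAlgebra p) D.S → Module.Finite (IwasawaAlgebra p) X.X →
      Module.IsTorsion (IwasawaAlgebra p) (D.S ⧸ CastellaGrossiLeeSkinner2022.stabilizedHeegnerModule D C) →
      HeegnerMuPartStabilized.HasSpecWitnesses p D.S X.X (CastellaGrossiLeeSkinner2022.stabilizedHeegnerModule D C) :=
  portCyclic_anyClassNumber_of_controlGlue h161 h411 hKS HeegnerMuPartControlGlue.controlGlueKS_anyClassNumber

/-- **The coherent-pair μ-letter with its torsion clause, from F-161 and F-411 ONLY, for ANY CLASS NUMBER** — p689159 §2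
(`HeegnerStabilizedOfKSLeaf.exists_coherentPair_isTorsion_muIneq_of_howard_kolyvaginSystem`) with exactly the three idle hypotheses
`¬ W.HasCM`, `HasPadicScalarImage`, `p ∣ h_K` removed; = part III's `_of_controlGlue` form at `HeegnerMuPartControlGlue.controlGlueKS_anyClassNumber`.
[cite: Howard2004HeegnerKolyvagin, Thm. 1.6.1 and proof of Thm. 2.2.10] [cite: CastellaGrossiLeeSkinner2022, Thm. 4.1.1 and Rem. 4.1.4]
[cite: PerrinRiou1987BSMF, §3.4 Prop. 10] -/
theorem exists_coherentPair_isTorsion_muIneq_of_howard_kolyvaginSystem_anyClassNumber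
    (h161 : thm161_dvrKolyvaginBound) (hKS : thm411_exists_kolyvaginSystem_one_ne_zero) :
    ∀ (N : ℕ) [NeZero N] (W : WeierstrassCurve ℚ) [W.IsGloballyMinimal] (K : Type) [Field K] [NumberField K]
      (p : ℕ) [Fact p.Prime] (κ : ZpExtension K p) (γ : Field.absoluteGaloisGroup K)
      (jbar : AlgebraicClosure K →+* ℂ),
      Thm413Hypotheses N W K p κ γ →
      W.HasIrreducibleModPGaloisRep p → (W.baseChange K).HasIrreducibleModPGaloisRep p →
      SatisfiesHeegnerHypothesis p K →
      ¬ p ∣ N →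
      (∀ k, ringClassSubgroup K (p ^ (k + 1)) jbar ≤ κ.layerSubgroup k) →
      Nat.card (ringClassGalOver (jbar.comp (algebraMap K (AlgebraicClosure K))) p 1) = p - 1 →
      ∀ (Dt : ModularParametrizationData W N) (β : ℤ), (4 * N : ℤ) ∣ β ^ 2 - NumberField.discr K →
      ∀ (D : (W.baseChange K).LambdaAdicSelmerData κ γ) (X : (W.baseChange K).SelmerDualData κ γ),
      ∃ (C : StabilizedHeegnerData N W K κ jbar) (F : HeegnerFamily N W K κ jbar),
        C.Dt = Dt ∧ F.Dt = Dt ∧ C.β = β ∧ F.β = β ∧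
        heegnerModule D F ≤ stabilizedHeegnerModule D C ∧
        (∃ g : IwasawaAlgebra p, g ≠ 0 ∧ g • stabilizedHeegnerModule D C ≤ heegnerModule D F) ∧
        (Module.Finite (IwasawaAlgebra p) D.S → Module.finrank (IwasawaAlgebra p) D.S = 1 →
          NoZeroSMulDivisors (IwasawaAlgebra p) D.S ∧
            Module.IsTorsion (IwasawaAlgebra p) (D.S ⧸ stabilizedHeegnerModule D C)) ∧
        (Module.Finite (IwasawaAlgebra p) D.S → Module.Finite (IwasawaAlgebra p) X.X →
          Module.finrank (IwasawaAlgebra p) D.S = 1 →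
          ∀ 𝔭 : PrimeSpectrum (IwasawaAlgebra p), 𝔭.asIdeal = Ideal.span {(p : IwasawaAlgebra p)} →
            Module.lengthAt (IwasawaAlgebra p) (Submodule.torsion (IwasawaAlgebra p) X.X) 𝔭 ≤
              2 * Module.lengthAt (IwasawaAlgebra p) (D.S ⧸ stabilizedHeegnerModule D C) 𝔭) :=
  exists_coherentPair_isTorsion_muIneq_of_howard_kolyvaginSystem_anyClassNumber_of_controlGlue h161 hKS
    HeegnerMuPartControlGlue.controlGlueKS_anyClassNumber

end Summit.BirchSwinnertonDyer.BirchSwinnertonDyer.Theorems.HeegnerMuPartKSAnyClassNumber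

end
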